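import Mathlib.Algebra.BigOperators.Finprod
import Mathlib.Data.Complex.Basic
import HarnessLib

/-!
# Kottwitz 1986, §6 «Global conjecture» — 6.1–6.2 (`obs₁`), Lemma 6.3, 6.4 (6.4.1), 6.5 (`obs`, (6.5.1)),
# Theorem 6.6, 6.7, 6.8, 6.9, the global hypothesis 6.10 ((6.10.1)), Remark 6.11 (pp. 381–385)

Topic `Literature/NumberTheory/Kottwitz1986` (carpet of R. E. Kottwitz, *Stable trace formula: elliptic singular terms*,
Math. Ann. 275 (1986) 365–399 [Kottwitz1986]; source of record = the GDZ Göttingen open-access digitisation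
(store key `paper:url-ecbc59a1db27`; per-page OCR `HOME/lit/lit3/g0/texts/Kottwitz1986-GDZ/p0381.txt … p0385.txt`,
canvas = printed page + 6; page images `T/KOT/TK-t06/g0/Kottwitz1986-GDZ/img/p0382.jpg`, `p0384.jpg`, `p0385.jpg`
READ for the displays (6.4.1), (6.5.1), (6.10.1) and the statements 6.3, 6.6–6.11). STATEMENTS ONLY (named facts,
D-0014): no theorem, no `sorry`, no `axiom`, no `instance`, no `notation`. Namespace
`Literature.NumberTheory.Kottwitz1986.GlobalConjecture` (squad TK file map, DEAL v1.1, 2026-09-02).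

## The printed statements (pp. 381–385)

«In this section `F` is a number field and `G` is a connected reductive group over `F`. We assume that `G_der` is
simply connected. Consider an inner twisting `ψ : G₀ → G` with `G₀` quasi-split. Let `γ₀` be a semi-simple element of
`G₀(F)`, and let `I₀` denote the centralizer of `γ₀` in `G₀`.

**6.1.** Let `γ` be an element of `G(𝔸)` that is conjugate to `ψ(γ₀)` under `G(𝔸̄)`. Our aim is to construct an
obstruction `obs(γ) ∈ 𝔎(I₀/F)^D` to the existence of an element of `G(F)` in the `G(𝔸)`-conjugacy class of `γ`. We
must assume that `G_sc` has no `E₈` factors, since the construction uses the Hasse principle for `G_sc` …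
**6.2.** The first step is to get an obstruction `obs₁(γ)` to the existence of an element of `G(F)` in the
`G_sc(𝔸)`-conjugacy class of `γ`. This obstruction lies in `A(I₁)`, where `I₁` is the centralizer of `γ₀` in
`(G₀)_sc` [with `A(·)` as in Sect. 2] …
**6.3. Lemma.** Assume that `G_sc` has no `E₈` factors. Then `γ` is `G_sc(𝔸)`-conjugate to an element of `G(F)` if and
only if `obs₁(γ)` is trivial.
**6.4.** Let `γ' ∈ G(𝔸)` and suppose that `γ'` is `G(𝔸̄)`-conjugate to `γ` … Therefore
`obs₁(γ') = obs₁(γ) · inv₁(γ, γ')`, where `inv₁(γ, γ')` denotes the image under `H¹(F, G_sc(𝔸̄)_γ) → A(I₁)` (6.4.1)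
of the class of `Y`.
**6.5.** Now we get `obs(γ)` from `obs₁(γ)` … By duality we get a homomorphism `A(I₁) → 𝔎(I₀/F)^D` (6.5.1), and we
define `obs(γ)` to be the image of `obs₁(γ)` under (6.5.1).
**6.6. Theorem.** Assume that `G_sc` has no `E₈` factors. Then `γ` is `G(𝔸)`-conjugate to an element of `G(F)` if and
only if `obs(γ)` is trivial.
**6.7.** Let `γ'`, `inv₁(γ, γ')` be as in 6.4. Let `inv(γ, γ')` be the image of `inv₁(γ, γ')` under the homomorphism
(6.5.1). Then `obs(γ') = obs(γ) · inv(γ, γ')`.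
**6.8.** Let `γ₀' ∈ G₀(F)` and suppose that `γ₀'` is stably conjugate to `γ₀`. Using `γ₀'` rather than `γ₀`, we get
`obs(γ)' ∈ 𝔎(I₀'/F)^D` … There is an inner twist `I₀' → I₀`, canonical up to conjugation by an element of `I₀(F̄)`.
This allows us to identify `𝔎(I₀'/F)^D` with `𝔎(I₀/F)^D`; with this identification we have `obs(γ)' = obs(γ)`.
**6.9.** … Let `(H, s, η)` be an endoscopic triple for `G`, and choose an extension of `η : Ĥ → Ĝ` to an
`L`-homomorphism `η' : ᴸH → ᴸG`. We assume that the local Conjecture 5.5 holds at every place of `F`. We write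
`Δ_v(·,·)` for the transfer factors at the place `v`. Recall that `Δ_v(·,·)` can be replaced by `c · Δ_v(·,·)` for any
`c ∈ ℂ^×`.
**6.10.** [not printed as a theorem — «the global hypothesis in Sect. 6» in the words of 9.3] For a suitable normalization of the local transfer factors the following statements hold.
(a) For any `(G, H)`-regular semi-simple `γ_H ∈ H(F)` and any `γ ∈ G(𝔸)` coming from `γ_H` the expression
`Π_v Δ_v(γ_H, γ)` has only a finite number of terms `≠ 1` and hence has a well-defined product, which we denote by
`Δ(γ_H, γ)`. (b) Let `γ_H, γ` be as in (a). Choose an inner twisting `ψ : G₀ → G` and `γ₀ ∈ G₀(F)` such that `γ₀`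
comes from `γ_H` (`γ₀` exists by [K1, Theorem 4.4]). Let `I₀` denote the centralizer of `γ₀` in `G₀`, and let
`obs(γ) ∈ 𝔎(I₀/F)^D` be the obstruction of 6.5. Then `Δ(γ_H, γ) = ⟨obs(γ), κ⟩` (6.10.1), where `κ ∈ 𝔎(I₀/F)` is
obtained from `s` via `Z(Ĥ) ↪ Z(Î_H) ≅ Z(Î₀)`.
**6.11. Remark.** We see from 6.8 that the right side of (6.10.1) is independent of the choice of `γ₀`. We see from
6.7 that the left and right sides are multiplied by the same factor if `γ` is replaced by a `G(𝔸̄)`-conjugate `γ'`.»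

## What is vendored, and in which vocabulary

ONE posited datum `GlobalConjectureData` (squad ruling V1; field names aligned with the squad file `Stabilization`
(§9) where the notions coincide: `SS0`, `KGroup`, `NoE8`, `DerSimplyConnected`, `Endo`; `KD`/`kdOne` as in the K92
squad file `KottwitzTriples`): the semisimple `γ₀ ∈ G₀(F)` with stable conjugacy, `G(𝔸)` as a bare carrier with
«`∈ G(F)`», conjugacy under `G(𝔸)`, `G_sc(𝔸)`, `G(𝔸̄)`, «`γ` comes from `γ₀`» (6.1), the abelian groups `A(I₁)` and
`𝔎(I₀/F)^D` as carriers with identity and multiplication (no instance fields), the pairing `⟨·,·⟩` with `𝔎(I₀/F)`,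
the map (6.5.1), `obs₁` (6.2), `inv₁` (6.4), the identification of 6.8, and for 6.9–6.11 the places, the endoscopic
triples, the `(G, H)`-regular semisimple `γ_H ∈ H(F)`, «comes from `γ_H`» (for `γ` and for `γ₀`), the local transfer
factors `Δ_v(γ_H, γ)`, «Conjecture 5.5 holds at every place», and `κ`. DEFINED over the datum: `obs` (6.5), `inv`
(6.7). Relations: `Kottwitz1986_6_3`, `Eq641` (6.4), `Kottwitz1986_6_6`, `Eq67`, `Eq68`, `GlobalHypothesis610` (6.10, AS A
PREDICATE — it is the «global hypothesis» later ASSUMED in 9.3; nothing asserts it), `Remark611`.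

VACUITY / JUNK audit: no defaulted field; the `Prop`-valued FIELDS are the two standing hypotheses of the print
(`DerSimplyConnected` p. 381, `NoE8` pp. 381–382) and «Conjecture 5.5 holds at every place» (6.9), used only as
antecedents; `finprod` in 6.10 (b) is guarded by the finiteness clause 6.10 (a) in the same statement; 6.10 is a PREDICATE
(hypothesis), never asserted.

## What is NOT here

The constructions of 6.2 (the torsor `X₀`, actions (i)–(iii), `β_{I₁}` of 2.2) and the proofs (pp. 382–384: Theorem
2.2, Kneser's vanishing, Proposition 2.6, the diagram with `C(D) = H¹(F, D̂)^D`); §§1–2, 4–5 of the source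
(`A(·)`, `𝔎`, `𝔈`, `𝔇`, Conjecture 5.5 — squad files `LocalCohomology`, `GlobalCohomology`, `RegularAndSigns`,
`LocalConjectures`); the later status of 6.10 (transfer factors of Langlands–Shelstad) — not recorded here.

## References

* R. E. Kottwitz, *Stable trace formula: elliptic singular terms*, Math. Ann. 275 (1986) 365–399: §6, pp. 381–385
  (6.3 p. 382, (6.4.1) p. 382, (6.5.1) p. 382, 6.6 p. 382, 6.7–6.10 p. 384, (6.10.1) p. 384, 6.11 p. 385); [K1] =
  Kottwitz, *Rational conjugacy classes in reductive groups*, Duke Math. J. 49 (1982), Thm. 4.4, as cited there.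
  [Kottwitz1986]
-/

noncomputable section

namespace Literature.NumberTheory.Kottwitz1986.GlobalConjecture

universe u

/-- **The data of Kottwitz's §6 AS A DATUM.** Fixed behind it (not fields): the number field `F`, the connected
reductive `F`-group `G` with `G_der` simply connected, the inner twisting `ψ : G₀ → G` with `G₀` quasi-split (p. 381).
Fields: the two standing hypotheses («`G_der` simply connected», «`G_sc` has no `E₈` factors»); the semi-simple
`γ₀ ∈ G₀(F)` (`SS0`) with stable conjugacy; `G(𝔸)` (`GA`) with «`∈ G(F)`», `G(𝔸)`-, `G_sc(𝔸)`-, `G(𝔸̄)`-conjugacy and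
«`γ` is conjugate to `ψ(γ₀)` under `G(𝔸̄)`» (6.1); `A(I₁)`, `I₁ = Cent_{(G₀)_sc}(γ₀)` (carrier, identity, product);
`obs₁(γ) ∈ A(I₁)` (6.2) and `inv₁(γ, γ') ∈ A(I₁)` (6.4); `𝔎(I₀/F)` (`KGroup`), `𝔎(I₀/F)^D` (`KD`, identity, product),
the pairing `⟨·,·⟩`, the homomorphism (6.5.1) `A(I₁) → 𝔎(I₀/F)^D` (`toKD`), the identification
`𝔎(I₀'/F)^D ≅ 𝔎(I₀/F)^D` of 6.8; for 6.9–6.11: the places of `F`, the endoscopic triples `(H, s, η)` (with `η'`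
chosen), the `(G, H)`-regular semi-simple `γ_H ∈ H(F)`, «`γ ∈ G(𝔸)` comes from `γ_H`», «`γ₀` comes from `γ_H`», the
local transfer factors `Δ_v(γ_H, γ)`, «the local Conjecture 5.5 holds at every place of `F`», and `κ ∈ 𝔎(I₀/F)`
obtained from `s`. No field asserts a printed statement. [cite: Kottwitz1986, §6 (pp. 381–384)] -/
structure GlobalConjectureData : Type (u + 1) where
  /-- standing hypothesis «We assume that `G_der` is simply connected» (name as in `Stabilization`) [§6 p. 381] -/
  DerSimplyConnected : Prop
  /-- «`G_sc` has no `E₈` factors» (Hasse principle for `G_sc`; name as in `Stabilization`) [§6.1 p. 381; 6.3, 6.6 p. 382] -/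
  NoE8 : Prop
  /-- the semi-simple elements `γ₀` of `G₀(F)` (name as in `Stabilization`) [§6 p. 381] -/
  SS0 : Type u
  /-- stable conjugacy in `G₀(F)` [§6.8 p. 384] -/
  IsStConj0 : SS0 → SS0 → Prop
  /-- `G(𝔸)` as a bare carrier [§6.1 p. 381] -/
  GA : Type u
  /-- «is an element of `G(F)`» (the image of `G(F) → G(𝔸)`) [§6.1 p. 381] -/
  IsRational : GA → Prop
  /-- conjugacy under `G(𝔸)` [§6.1 p. 381; 6.6 p. 382] -/
  IsConjA : GA → GA → Prop
  /-- conjugacy under `G_sc(𝔸)` [§6.2 p. 381; 6.3 p. 382] -/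
  IsConjAsc : GA → GA → Prop
  /-- conjugacy under `G(𝔸̄)` [§6.4 p. 382] -/
  IsConjAbar : GA → GA → Prop
  /-- «`γ` is an element of `G(𝔸)` that is conjugate to `ψ(γ₀)` under `G(𝔸̄)`» [§6.1 p. 381] -/
  ComesFrom : GA → SS0 → Prop
  /-- `A(I₁)`, `I₁` the centralizer of `γ₀` in `(G₀)_sc`, `A(·)` as in Sect. 2 [§6.2 p. 381] -/
  A1 : SS0 → Type u
  /-- the trivial element of `A(I₁)` [§6.3 p. 382] -/
  a1One : (γ₀ : SS0) → A1 γ₀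
  /-- the group law of `A(I₁)` [§6.4 (6.4.1) p. 382] -/
  a1Mul : {γ₀ : SS0} → A1 γ₀ → A1 γ₀ → A1 γ₀
  /-- `obs₁(γ) ∈ A(I₁)`: the image under `β_{I₁}` (2.2) of the class of the torsor `X = X₀/G_sc(F̄)` [§6.2 pp. 381–382] -/
  obs1 : {γ₀ : SS0} → (γ : GA) → ComesFrom γ γ₀ → A1 γ₀
  /-- `inv₁(γ, γ') ∈ A(I₁)`: the image under `H¹(F, G_sc(𝔸̄)_γ) → A(I₁)` (6.4.1) of the class of
  `Y = {h ∈ G_sc(𝔸̄) | hγh⁻¹ = γ'}` [§6.4 (6.4.1) p. 382] -/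
  inv1 : {γ₀ : SS0} → (γ γ' : GA) → ComesFrom γ γ₀ → IsConjAbar γ γ' → A1 γ₀
  /-- `𝔎(I₀/F)` (name as in `Stabilization`) [§4; §6.1 p. 381] -/
  KGroup : SS0 → Type u
  /-- `𝔎(I₀/F)^D`, the Pontryagin dual [§6.1 p. 381; (6.5.1) p. 382] -/
  KD : SS0 → Type u
  /-- the trivial element of `𝔎(I₀/F)^D` [§6.6 p. 382] -/
  kdOne : (γ₀ : SS0) → KD γ₀
  /-- the group law of `𝔎(I₀/F)^D` [§6.7 p. 384] -/
  kdMul : {γ₀ : SS0} → KD γ₀ → KD γ₀ → KD γ₀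
  /-- the duality pairing `⟨·,·⟩ : 𝔎(I₀/F)^D × 𝔎(I₀/F) → ℂ^×` [§6.10 (6.10.1) p. 384] -/
  pair : {γ₀ : SS0} → KD γ₀ → KGroup γ₀ → ℂ
  /-- the homomorphism `A(I₁) → 𝔎(I₀/F)^D` (6.5.1), dual to `𝔎(I₀/F) ⊂ π₀(Z(Î₁)^Γ)` [§6.5 (6.5.1) p. 382] -/
  toKD : {γ₀ : SS0} → A1 γ₀ → KD γ₀
  /-- the identification `𝔎(I₀'/F)^D ≅ 𝔎(I₀/F)^D` for `γ₀'` stably conjugate to `γ₀` (via the inner twist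
  `I₀' → I₀`, canonical up to `I₀(F̄)`-conjugacy) [§6.8 p. 384] -/
  kdTransport : {γ₀ γ₀' : SS0} → IsStConj0 γ₀ γ₀' → KD γ₀' → KD γ₀
  /-- the places `v` of `F` [§6.6 p. 382; 6.9 p. 384] -/
  Place : Type u
  /-- the endoscopic triples `(H, s, η)` for `G`, with a chosen extension `η' : ᴸH → ᴸG` (name as in
  `Stabilization`) [§6.9 p. 384] -/
  Endo : Type u
  /-- the `(G, H)`-regular semi-simple elements `γ_H ∈ H(F)` [§6.10 (a) p. 384] -/
  SSHreg : Endo → Type u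
  /-- «`γ ∈ G(𝔸)` coming from `γ_H`» [§6.10 (a) p. 384] -/
  ComesFromH : (e : Endo) → GA → SSHreg e → Prop
  /-- «`γ₀ ∈ G₀(F)` such that `γ₀` comes from `γ_H`» ([K1, Theorem 4.4]) [§6.10 (b) p. 384] -/
  ComesFrom0H : (e : Endo) → SSHreg e → SS0 → Prop
  /-- the local transfer factor `Δ_v(γ_H, γ)` at the place `v` (evaluated at the `v`-component of `γ ∈ G(𝔸)`; only
  defined up to `c ∈ ℂ^×`) [§6.9 p. 384] -/
  localTF : (e : Endo) → Place → SSHreg e → GA → ℂ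
  /-- «We assume that the local Conjecture 5.5 holds at every place of `F`» [§6.9 p. 384] -/
  LocalConjecture55 : Prop
  /-- `κ ∈ 𝔎(I₀/F)` obtained from `s` via `Z(Ĥ) ↪ Z(Î_H) ≅ Z(Î₀)` (`I_H = H_{γ_H}⁰`) [§6.10 (b) p. 384] -/
  kappa : (e : Endo) → (γH : SSHreg e) → (γ₀ : SS0) → ComesFrom0H e γH γ₀ → KGroup γ₀

namespace GlobalConjectureData

variable (D : GlobalConjectureData.{u})

/-- **6.5**: «we define `obs(γ)` to be the image of `obs₁(γ)` under (6.5.1)» — DEFINED over the datum.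
[cite: Kottwitz1986, §6.5 (p. 382)] -/
def obs {γ₀ : D.SS0} (γ : D.GA) (h : D.ComesFrom γ γ₀) : D.KD γ₀ :=
  D.toKD (D.obs1 γ h)

/-- **6.7**: «Let `inv(γ, γ')` be the image of `inv₁(γ, γ')` under the homomorphism (6.5.1)» — DEFINED over the
datum. [cite: Kottwitz1986, §6.7 (p. 384)] -/
def inv {γ₀ : D.SS0} (γ γ' : D.GA) (h : D.ComesFrom γ γ₀) (hc : D.IsConjAbar γ γ') : D.KD γ₀ :=
  D.toKD (D.inv1 γ γ' h hc)

/-! ## The printed statements of §6 as relations over the datum -/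

/-- **6.3. LEMMA**: «Assume that `G_sc` has no `E₈` factors. Then `γ` is `G_sc(𝔸)`-conjugate to an element of `G(F)`
if and only if `obs₁(γ)` is trivial.», AS A RELATION over the datum (under the standing hypothesis of §6).
[cite: Kottwitz1986, Lemma 6.3 (p. 382)] -/
def Kottwitz1986_6_3 : Prop :=
  D.DerSimplyConnected → D.NoE8 →
    ∀ (γ₀ : D.SS0) (γ : D.GA) (h : D.ComesFrom γ γ₀),
      (∃ γ₁ : D.GA, D.IsRational γ₁ ∧ D.IsConjAsc γ γ₁) ↔ D.obs1 γ h = D.a1One γ₀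

/-- **6.4, (6.4.1)**: «`obs₁(γ') = obs₁(γ) · inv₁(γ, γ')`» for `γ' ∈ G(𝔸)` `G(𝔸̄)`-conjugate to `γ`, AS A RELATION
over the datum. [cite: Kottwitz1986, §6.4 (6.4.1) (p. 382)] -/
def Eq641 : Prop :=
  D.DerSimplyConnected →
    ∀ (γ₀ : D.SS0) (γ γ' : D.GA) (h : D.ComesFrom γ γ₀) (h' : D.ComesFrom γ' γ₀) (hc : D.IsConjAbar γ γ'),
      D.obs1 γ' h' = D.a1Mul (D.obs1 γ h) (D.inv1 γ γ' h hc)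

/-- **6.6. THEOREM**: «Assume that `G_sc` has no `E₈` factors. Then `γ` is `G(𝔸)`-conjugate to an element of `G(F)`
if and only if `obs(γ)` is trivial.», AS A RELATION over the datum. [cite: Kottwitz1986, Theorem 6.6 (p. 382)] -/
def Kottwitz1986_6_6 : Prop :=
  D.DerSimplyConnected → D.NoE8 →
    ∀ (γ₀ : D.SS0) (γ : D.GA) (h : D.ComesFrom γ γ₀),
      (∃ γ₁ : D.GA, D.IsRational γ₁ ∧ D.IsConjA γ γ₁) ↔ D.obs γ h = D.kdOne γ₀

/-- **6.7**: «Then `obs(γ') = obs(γ) · inv(γ, γ')`.», AS A RELATION over the datum. [cite: Kottwitz1986, §6.7 (p. 384)] -/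
def Eq67 : Prop :=
  D.DerSimplyConnected →
    ∀ (γ₀ : D.SS0) (γ γ' : D.GA) (h : D.ComesFrom γ γ₀) (h' : D.ComesFrom γ' γ₀) (hc : D.IsConjAbar γ γ'),
      D.obs γ' h' = D.kdMul (D.obs γ h) (D.inv γ γ' h hc)

/-- **6.8**: for `γ₀'` stably conjugate to `γ₀`, «with this identification we have `obs(γ)' = obs(γ)`» (the
obstruction built from `γ₀'`, transported along `𝔎(I₀'/F)^D ≅ 𝔎(I₀/F)^D`, equals the one built from `γ₀`), AS A
RELATION over the datum. [cite: Kottwitz1986, §6.8 (p. 384)] -/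
def Eq68 : Prop :=
  D.DerSimplyConnected →
    ∀ (γ₀ γ₀' : D.SS0) (s : D.IsStConj0 γ₀ γ₀') (γ : D.GA) (h : D.ComesFrom γ γ₀) (h' : D.ComesFrom γ γ₀'),
      D.kdTransport s (D.obs γ h') = D.obs γ h

/-- **6.10 — the «global hypothesis» of Sect. 6** (so called in 9.3, p. 393, where it is ASSUMED; printed as 6.10,
p. 384, not as a theorem), AS A PREDICATE on the datum — a hypothesis consumers carry (squad file
`Stabilization`, field `LocalGlobalHypotheses`); nothing here asserts it and its later status is not recorded here:
«For a suitable normalization of the local transfer factors the following statements hold. (a) For any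
`(G, H)`-regular semi-simple `γ_H ∈ H(F)` and any `γ ∈ G(𝔸)` coming from `γ_H` the expression `Π_v Δ_v(γ_H, γ)` has only
a finite number of terms `≠ 1` and hence has a well-defined product, which we denote by `Δ(γ_H, γ)`. (b) Let `γ_H, γ`
be as in (a). Choose … `γ₀ ∈ G₀(F)` such that `γ₀` comes from `γ_H` … Then `Δ(γ_H, γ) = ⟨obs(γ), κ⟩` (6.10.1).»
Typed: there is a rescaling `c_v ∈ ℂ^×` of each `Δ_v` (6.9: «`Δ_v` can be replaced by `c · Δ_v`») for which (a) and
(b) hold. [cite: Kottwitz1986, §6.10 (6.10.1) (p. 384)] -/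
def GlobalHypothesis610 : Prop :=
  D.DerSimplyConnected → D.LocalConjecture55 →
    ∃ c : (e : D.Endo) → D.Place → ℂ, (∀ e v, c e v ≠ 0) ∧
      (∀ (e : D.Endo) (γH : D.SSHreg e) (γ : D.GA), D.ComesFromH e γ γH →
        (Function.mulSupport fun v => c e v * D.localTF e v γH γ).Finite) ∧
      (∀ (e : D.Endo) (γH : D.SSHreg e) (γ : D.GA), D.ComesFromH e γ γH →
        ∀ (γ₀ : D.SS0) (h₀ : D.ComesFrom0H e γH γ₀) (h : D.ComesFrom γ γ₀),
          ∏ᶠ v, c e v * D.localTF e v γH γ = D.pair (D.obs γ h) (D.kappa e γH γ₀ h₀))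

/-- **6.11. REMARK**: «We see from 6.8 that the right side of (6.10.1) is independent of the choice of `γ₀`. We see
from 6.7 that the left and right sides are multiplied by the same factor if `γ` is replaced by a `G(𝔸̄)`-conjugate
`γ'`.», AS A RELATION over the datum. The second clause is stated, as in 6.10, for NORMALISED factors `c_v · Δ_v`
(`c_v ≠ 0`) whose products over `v` are genuinely finite (6.10 (a)) — both finiteness conditions are antecedents, so
the `finprod`s are never the junk value (review of p847983). [cite: Kottwitz1986, Remark 6.11 (p. 385)] -/
def Remark611 : Prop :=
  D.DerSimplyConnected →
    (∀ (e : D.Endo) (γH : D.SSHreg e) (γ : D.GA) (γ₀ γ₀' : D.SS0)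
        (h₀ : D.ComesFrom0H e γH γ₀) (h₀' : D.ComesFrom0H e γH γ₀') (h : D.ComesFrom γ γ₀) (h' : D.ComesFrom γ γ₀'),
        D.pair (D.obs γ h) (D.kappa e γH γ₀ h₀) = D.pair (D.obs γ h') (D.kappa e γH γ₀' h₀')) ∧
    (∀ (e : D.Endo) (γH : D.SSHreg e) (γ γ' : D.GA) (γ₀ : D.SS0) (h₀ : D.ComesFrom0H e γH γ₀)
        (h : D.ComesFrom γ γ₀) (h' : D.ComesFrom γ' γ₀), D.IsConjAbar γ γ' →
        D.ComesFromH e γ γH → D.ComesFromH e γ' γH →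
        ∀ c : D.Place → ℂ, (∀ v, c v ≠ 0) →
          (Function.mulSupport fun v => c v * D.localTF e v γH γ).Finite →
          (Function.mulSupport fun v => c v * D.localTF e v γH γ').Finite →
          ∃ a : ℂ, (∏ᶠ v, c v * D.localTF e v γH γ') = a * ∏ᶠ v, c v * D.localTF e v γH γ ∧
            D.pair (D.obs γ' h') (D.kappa e γH γ₀ h₀) = a * D.pair (D.obs γ h) (D.kappa e γH γ₀ h₀))

end GlobalConjectureData

end Literature.NumberTheory.Kottwitz1986.GlobalConjecture
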